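import Literature.Topology.FourManifolds.HomotopySpheresStablyParallelizableSpinSixCover
import Literature.Topology.FourManifolds.HomotopySpheresStablyParallelizableGeneralLinear
import HarnessLib

/-!
# Bott's `π₆(SO(8)) = 0` from the stable triviality of `π₆(GL(ℂ))`: the last elementary reduction

Topic `Literature/Topology/FourManifolds`, sibling of `…SpinSixCover.lean` (the named fact
`Literature.Topology.FourManifolds.Bott1959_sphereMapsToStableFramesExtend_six`, `π₆(SO(8), 1) = 0`
(Bott 1959), follows from the null-homotopy through `GL₄(ℂ)` of all maps `𝕊⁶ → SU(4)`) and of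
`…GeneralLinear.lean` (stability: `πᵢ(GL_n(ℂ)) → πᵢ(GL_{n+j}(ℂ))` is injective for `i < 2n`). Here
the two are combined with the passage between free homotopy classes of maps of round spheres and
based cube classes (everything PROVED; no named facts):

* §1 **per-map destabilisation** (`GLTransport.nullhomotopic_of_appendMany_comp_nullhomotopic`):
  for `1 ≤ i < 2n`, a continuous `g : 𝕊ⁱ → GL_n(ℂ)` whose stabilisation `ι^j ∘ g : 𝕊ⁱ → GL_{n+j}(ℂ)`
  is null-homotopic is itself null-homotopic. Proof: translate `g` to be `1` at the base point,
  read it as a based cube class through the collapse `pc : Iⁱ → 𝕊ⁱ` of `…Even.lean`, turn the free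
  null-homotopy of `ι^j ∘ g` into a based one (Hatcher §4.1, `β_γ`; the tree's
  `genLoop_homotopic_const_of_free`), destabilise the cube class
  (`GLTransport.genLoop_homotopic_const_of_appendMany`), and descend the resulting homotopy rel `∂Iⁱ`
  back through the quotient map `𝟙 × pc`.
* §2 **`Bott1959_sphereMapsToStableFramesExtend_six_of_stablyNullhomotopic`**: if every
  continuous `g : 𝕊⁶ → GL₄(ℂ)` becomes null-homotopic after some stabilisation `ι^j`, then the named
  fact holds — this hypothesis is exactly what complex Bott periodicity provides through
  `K̃⁰(𝕊⁷) = 0` ("every clutching function over `𝕊⁷` is stably trivial"; Bott 1959 §1: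
  `π₆(U) = 0`). Variants: from `π₆(GL₄(ℂ), 1) = 0`, and from `π₆(GL_{4+j}(ℂ), 1) = 0` for one `j`.

## References

* R. Bott, *The stable homotopy of the classical groups*, Ann. of Math. (2) 70 (1959), 313–337, §1
  (`π_k(U) = 0` for `k` even; stable range `k < 2n`). doi:10.2307/1970106 [Bott1959]
* A. Hatcher, *Algebraic Topology*, CUP (2002), §4.1 (p. 341 `β_γ`, p. 346 criterion for
  `πₙ = 0`), §4.2 Example 4.55. [HatcherAT2002]
-/

noncomputable section

open Matrix Set Metric Literature.AlgebraicTopology.Homotopy Literature.LinearAlgebra.Matrix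
open scoped Topology Topology.Homotopy unitInterval

namespace Literature.Topology.FourManifolds

namespace GLTransport

open EvenSphere

/-! ### 1. Per-map destabilisation for maps of spheres into `GL_n(ℂ)` -/

section PerMap

variable {n i : ℕ}

/-- `ι^j` is multiplicative. [folklore] -/
theorem appendMany_mul (j : ℕ) (A B : GLd n) : appendMany n j (A * B) = appendMany n j A * appendMany n j B := by
  induction j with
  | zero => rfl
  | succ j ih =>
    rw [appendMany_succ, appendMany_succ, appendMany_succ, ih]
    exact Subtype.ext (by simp [appendOne_mul])

/-- `ι^j (A⁻¹) = (ι^j A)⁻¹`. [folklore] -/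
theorem appendMany_inv (j : ℕ) (A : GLd n) : appendMany n j A⁻¹ = (appendMany n j A)⁻¹ :=
  eq_inv_of_mul_eq_one_left (by rw [← appendMany_mul, inv_mul_cancel, appendMany_one])

/-- Post-composition with a continuous self-map preserves null-homotopy: Mathlib's
`ContinuousMap.Nullhomotopic.comp_right`; deprecated restatement (dedup-01133, 2026-08-16).
[folklore] -/
@[deprecated ContinuousMap.Nullhomotopic.comp_right (since := "2026-08-16")]
theorem nullhomotopic_comp {X Y Z : Type*} [TopologicalSpace X] [TopologicalSpace Y]
    [TopologicalSpace Z] (L : C(Y, Z)) {g : C(X, Y)} (h : g.Nullhomotopic) :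
    (L.comp g).Nullhomotopic :=
  h.comp_right L

/-- **Descent of a homotopy rel `∂Iⁱ` through the collapse `pc : Iⁱ → 𝕊ⁱ`** (`i ≥ 1`): a continuous
`F : I × Iⁱ → Z` which at each time takes equal values at points with the same image under `pc`
(i.e. is constant on `∂Iⁱ` at each time) is `G ∘ (𝟙 × pc)` for a continuous `G : I × 𝕊ⁱ → Z`
(`𝟙 × pc` is a closed surjection from a compact space, hence a quotient map). [folklore] -/
theorem exists_descend_pc [NeZero i] {Z : Type*} [TopologicalSpace Z] (F : C(I × (Fin i → I), Z))
    (hF : ∀ t, ∀ y ∈ Cube.boundary (Fin i), ∀ y' ∈ Cube.boundary (Fin i), F (t, y) = F (t, y')) :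
    ∃ G : C(I × sphere (0 : EuclideanSpace ℝ (Fin (i + 1))) 1, Z), ∀ t y, G (t, pc y) = F (t, y) := by
  have hs : Function.Surjective (pc : (Fin i → I) → sphere (0 : EuclideanSpace ℝ (Fin (i + 1))) 1) :=
    fun u => ⟨(exists_pc_eq u).choose, (exists_pc_eq u).choose_spec.1⟩
  choose s hs' using hs
  have key : ∀ t y, F (t, s (pc y)) = F (t, y) := fun t y => by
    rcases pc_eq_pc_imp (hs' (pc y)) with h | ⟨h1, h2⟩
    · rw [h]
    · exact hF t _ h1 _ h2
  let q : I × (Fin i → I) → I × sphere (0 : EuclideanSpace ℝ (Fin (i + 1))) 1 := fun z => (z.1, pc z.2)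
  have hqc : Continuous q := continuous_fst.prodMk (pc.continuous.comp continuous_snd)
  have hq : Topology.IsQuotientMap q :=
    (hqc.isClosedMap).isQuotientMap hqc fun z => ⟨(z.1, s z.2), Prod.ext rfl (hs' z.2)⟩
  have hGc : Continuous fun z : I × sphere (0 : EuclideanSpace ℝ (Fin (i + 1))) 1 => F (z.1, s z.2) := by
    rw [hq.continuous_iff]
    have : (fun z : I × sphere (0 : EuclideanSpace ℝ (Fin (i + 1))) 1 => F (z.1, s z.2)) ∘ q = fun z => F z := by
      funext z; exact key z.1 z.2
    rw [this]; exact F.continuous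
  exact ⟨⟨fun z => F (z.1, s z.2), hGc⟩, fun t y => key t y⟩

/-- **Per-map destabilisation.** For `1 ≤ i < 2n`, a continuous map `g : 𝕊ⁱ → GL_n(ℂ)` whose `j`-fold
stabilisation `ι^j ∘ g : 𝕊ⁱ → GL_{n+j}(ℂ)` is null-homotopic is null-homotopic (stable range, Bott
1959 §1; Hatcher §4.1 for the passage between free sphere maps and based cube classes).
[cite: Bott1959, §1 (stable range)] [cite: HatcherAT2002, §4.1 (p. 341, p. 346)] -/
theorem nullhomotopic_of_appendMany_comp_nullhomotopic (hi : i < 2 * n) (hi1 : 1 ≤ i) (j : ℕ)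
    (g : C(sphere (0 : EuclideanSpace ℝ (Fin (i + 1))) 1, GLd n))
    (h : ((appendMany n j).comp g).Nullhomotopic) : g.Nullhomotopic := by
  haveI : NeZero i := ⟨by omega⟩
  -- translate to be `1` at the base point `u₀ = pc(∂Iⁱ)`
  set u₀ : sphere (0 : EuclideanSpace ℝ (Fin (i + 1))) 1 := lastPt i with hu₀
  set B : GLd n := g u₀ with hB
  let g' : C(sphere (0 : EuclideanSpace ℝ (Fin (i + 1))) 1, GLd n) := ⟨fun u => B⁻¹ * g u, continuous_const.mul g.continuous⟩
  have hg'₀ : g' u₀ = 1 := inv_mul_cancel B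
  have h' : ((appendMany n j).comp g').Nullhomotopic := by
    let L : C(GLd (n + j), GLd (n + j)) := ⟨fun C => (appendMany n j B)⁻¹ * C, continuous_const.mul continuous_id⟩
    have hL : L.comp ((appendMany n j).comp g) = (appendMany n j).comp g' := by
      ext u : 1
      change (appendMany n j B)⁻¹ * appendMany n j (g u) = appendMany n j (B⁻¹ * g u)
      rw [appendMany_mul, appendMany_inv]
    rw [← hL]
    exact h.comp_right L
  -- the based cube class of `g'`
  let f : Ω^ (Fin i) (GLd n) 1 := ⟨g'.comp pc, fun y hy => by
    change g' (pc y) = 1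
    rw [pc_eq_lastPt_of_mem hy]; exact hg'₀⟩
  -- its stabilisation is null-homotopic rel `∂Iⁱ` (free ⇒ based)
  obtain ⟨c, ⟨G⟩⟩ := h'
  have hf : GenLoop.Homotopic (genLoopMap (appendMany n j) 1 f) GenLoop.const := by
    refine genLoop_homotopic_const_of_free _ ⟨fun z => G (z.1, pc z.2),
      G.continuous.comp (continuous_fst.prodMk (pc.continuous.comp continuous_snd))⟩
      ⟨fun t => G (t, u₀), G.continuous.comp (continuous_id.prodMk continuous_const)⟩
      (fun y => ?_) (fun t y hy => ?_) (fun y => ?_) ?_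
    · change G (0, pc y) = appendMany n j (g' (pc y))
      rw [G.apply_zero]; rfl
    · change G (t, pc y) = G (t, u₀)
      rw [pc_eq_lastPt_of_mem hy]
    · change G (1, pc y) = G (1, u₀)
      rw [G.apply_one, G.apply_one]; rfl
    · change G (0, u₀) = appendMany n j 1
      rw [G.apply_zero]
      change appendMany n j (g' u₀) = _
      rw [hg'₀]
  -- destabilise the cube class
  obtain ⟨Hf⟩ := genLoop_homotopic_const_of_appendMany hi j f hf
  -- descend the null-homotopy rel `∂Iⁱ` through `pc`
  obtain ⟨G', hG'⟩ := exists_descend_pc (Z := GLd n) Hf.toContinuousMap fun t y hy y' hy' => by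
    change Hf (t, y) = Hf (t, y')
    rw [Hf.eq_fst t hy, Hf.eq_fst t hy']
    change g' (pc y) = g' (pc y')
    rw [pc_eq_lastPt_of_mem hy, pc_eq_lastPt_of_mem hy']
  have hg' : g'.Homotopic (ContinuousMap.const _ (1 : GLd n)) := by
    refine ⟨{ toFun := fun z => G' z
              continuous_toFun := G'.continuous
              map_zero_left := fun u => ?_
              map_one_left := fun u => ?_ }⟩
    · obtain ⟨y, rfl⟩ : ∃ y, pc y = u := ⟨_, (exists_pc_eq u).choose_spec.1⟩
      rw [hG']
      exact Hf.apply_zero y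
    · obtain ⟨y, rfl⟩ : ∃ y, pc y = u := ⟨_, (exists_pc_eq u).choose_spec.1⟩
      rw [hG']
      exact Hf.apply_one y
  -- translate back
  let Lg : C(GLd n, GLd n) := ⟨fun C => B * C, continuous_const.mul continuous_id⟩
  have hLg : Lg.comp g' = g := by
    ext u : 1
    exact mul_inv_cancel_left B (g u)
  rw [← hLg]
  exact ContinuousMap.Nullhomotopic.comp_right ⟨1, hg'⟩ Lg

end PerMap

end GLTransport

/-! ### 2. The named fact from the stable triviality of `π₆(GL(ℂ))` -/

open GLTransport

/-- **Bott's `π₆(SO(8)) = 0` (the named fact `Bott1959_sphereMapsToStableFramesExtend_six`) from the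
stable triviality of maps `𝕊⁶ → GL₄(ℂ)`**: if every continuous `g : 𝕊⁶ → GL₄(ℂ)` is null-homotopic
after some stabilisation `ι^j : GL₄(ℂ) → GL_{4+j}(ℂ)` — which is what complex Bott periodicity gives
through `K̃⁰(𝕊⁷) = 0` (every clutching function of a bundle over `𝕊⁷` is stably trivial; Bott 1959
§1: `π₆(U) = 0`) — then the fact holds. *Proof.* Destabilise (`6 < 2 · 4`,
`nullhomotopic_of_appendMany_comp_nullhomotopic`), so every `𝕊⁶ → GL₄(ℂ)` is null-homotopic, in
particular every `𝕊⁶ → SU(4) ⊂ GL₄(ℂ)`; conclude by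
`Bott1959_sphereMapsToStableFramesExtend_six_of_nullhomotopic_suIncl` (Gram–Schmidt retraction into
`SU(4)`, the covering `SU(4) → SO(6)`, `π₆(SO(6)) = 0 ⇒ π₆(SO(7)) = 0 ⇒ π₆(SO(8)) = 0`).
[cite: Bott1959, §1, Corollary to Theorem II, (1.5), p. 315] -/
theorem Bott1959_sphereMapsToStableFramesExtend_six_of_stablyNullhomotopic
    (H : ∀ g : C(sphere (0 : EuclideanSpace ℝ (Fin 7)) 1, GLd 4), ∃ j : ℕ, ((appendMany 4 j).comp g).Nullhomotopic) :
    Bott1959_sphereMapsToStableFramesExtend_six := by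
  refine Bott1959_sphereMapsToStableFramesExtend_six_of_nullhomotopic_suIncl fun K => ?_
  obtain ⟨j, hj⟩ := H (suIncl.comp K)
  exact nullhomotopic_of_appendMany_comp_nullhomotopic (i := 6) (n := 4) (by norm_num) (by norm_num) j _ hj

/-- **The named fact from `π₆(GL₄(ℂ), 1) = 0`.** [cite: Bott1959, §1, (1.5), p. 315] -/
theorem Bott1959_sphereMapsToStableFramesExtend_six_of_subsingleton_homotopyGroup_GL_four
    (h : Subsingleton (π_ 6 (GLd 4) 1)) : Bott1959_sphereMapsToStableFramesExtend_six := by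
  refine Bott1959_sphereMapsToStableFramesExtend_six_of_stablyNullhomotopic fun g => ⟨0, ?_⟩
  change g.Nullhomotopic
  haveI : PathConnectedSpace (GLd 4) := pathConnectedSpace_isUnit_det
  have hπ : 1 ≤ 6 → ∀ y : GLd 4, Subsingleton (π_ 6 (GLd 4) y) := fun _ y => by
    let φ : C(GLd 4, GLd 4) := ⟨fun C => y⁻¹ * C, continuous_const.mul continuous_id⟩
    let ψ : C(GLd 4, GLd 4) := ⟨fun C => y * C, continuous_const.mul continuous_id⟩
    have hψφ : (ψ.comp φ).Homotopic (ContinuousMap.id _) := by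
      rw [show ψ.comp φ = ContinuousMap.id _ from ContinuousMap.ext fun C => mul_inv_cancel_left y C]
    have h1 : Subsingleton (π_ 6 (GLd 4) (φ y)) := by
      rw [show φ y = 1 from inv_mul_cancel y]; exact h
    exact subsingleton_homotopyGroup_of_leftHomotopyInverse φ ψ hψφ y h1
  exact ⟨1, homotopic_const_of_sphere_of_subsingleton_homotopyGroup (E := EuclideanSpace ℝ (Fin 7))
    (m := 6) finrank_euclideanSpace_fin hπ g 1⟩

/-- **The named fact from `π₆(GL_{4+j}(ℂ), 1) = 0` for a single `j`** (stability brings it down to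
`GL₄(ℂ)`). [cite: Bott1959, §1 (stable range), (1.5), p. 315] -/
theorem Bott1959_sphereMapsToStableFramesExtend_six_of_subsingleton_homotopyGroup_GL_add (j : ℕ)
    (h : Subsingleton (π_ 6 (GLd (4 + j)) 1)) : Bott1959_sphereMapsToStableFramesExtend_six :=
  Bott1959_sphereMapsToStableFramesExtend_six_of_subsingleton_homotopyGroup_GL_four
    (subsingleton_homotopyGroup_GLd_of_add (n := 4) (i := 6) (by norm_num) j h)

end Literature.Topology.FourManifolds
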